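import Summits.CriticalPhenomena.PercolationContinuityZ3.Theorems.PercNearOneGluingNoHeavyConstsNoHeavyRateHalf
import HarnessLib

/-!
# The reach-free linear lower-tail constant: the best PAIR-MARGINAL upper bound `C(κ) ≤ 1 + 1/(2(1−κ))`

builds on p205010 (kernel theorem, internal audit signed; external expert review pending)

PAPER-2 track "percolation constants", part (ii), seat `prim-consts-1` (lane index `run/shared/lean/prim/consts/CONSTANTS.md`,
row A19; memo `FROM-prim-consts-1-g3-STAIRCASE-AND-PAIR-BARRIER.md`).  Support file for the crux `NoHeavyLowerTail`
(stmt-CriticalPhenomena-4575; `--supports … --as helper`): theorems only, no definitions, no sorries, standard axioms.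

Notation (finite weighted graph on `Fin n`, relay set `A`, `M = |A|`, observer `o`): `N = |C(o) ∩ A|`, `EN = Σ_a P(o ↔ a)`,
`s ≥ max_{a,a'∈A} P(a ↮ a')`.

* `Consts.measureReal_le_sum_mul_inter` — WEIGHTED double counting on a finite probability space: if every point of `S` is covered
  with total weight `≥ 1` by the sets `T i` (weights `c i ≥ 0`), then `μ(S) ≤ Σ_i c_i μ(S ∩ T_i)`.
* `Consts.real_lowerTail_le_pairLP` — **`P(1 ≤ N < κ·EN) ≤ (1 + 1/(2(1−κ)))·s` for every `0 < κ < 1`.**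
  Proof: charge the bad event to TWO families — the `M` events `{o ↔ A, o ↮ y}` (mass `≤ s` each, one-cut `AdditiveGluing`, as in
  `…ConstsNoHeavyRateHalf`) with weight `α`, and the `M(M−1)` ordered-pair events `{o ↔ x, o ↮ y}` with weight `β`; the two events
  of an unordered pair `{x, y}` are disjoint sub-events of `{x ↮ y}`, so the second family has total mass `≤ s·M(M−1)/2`.  On a bad
  outcome with `N` points joined to `o` the total weight is `(M − N)(α + βN)`, which is `≥ 1` on `[1, θ]` for
  `α = (M−θ−1)/((M−1)(M−θ))`, `β = 1/((M−1)(M−θ))` (`θ = min(κM, M−1)`; `(M−N)(M−θ−1+N) = (M−1)(M−θ) + (N−1)(θ−N)`), giving the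
  bound `s·(M/(M−θ))·((M−θ−1)/(M−1) + 1/2) ≤ (1 + 1/(2(1−κ)))·s`.
  For `κ ≤ 1/2` the companion bound `1/(1−κ)` (`Consts.real_lowerTail_le_div`) is smaller; on `(1/2, 1)` this file improves it
  (`3 → 5/2` at `κ = 2/3`), so the kernel now has `C(κ) ∈ [(1 + b(κ))/2, 1 + 1/(2(1−κ))]` on `(1/2, 1)` (lower side:
  `…ConstsLinearLowerTailStaircase`).  REMARK (memo §2, not formalised): `min(1/(1−κ), 1 + 1/(2(1−κ)))` is the OPTIMUM of the
  linear programme over arbitrary partition laws with pairwise separation `≤ s` (extremal law: the exchangeable random halving), so no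
  pair-marginal argument can certify the conjectured `3/2` (`Consts.LinearLowerTailThreeHalves`) or move the crux's linear rate above
  `κ = 1/2` (`κ·(1 + 1/(2(1−κ))) ≤ 1 ⇔ κ ≤ 1/2`).
References: G. Kozma, N. Nitzan, arXiv:2401.12397 (2024), Conjecture 1 (p. 3); G. Grimmett, *Percolation* (1999), §1.3.
-/

noncomputable section

namespace Summit.CriticalPhenomena.PercolationContinuityZ3.Theorems

open MeasureTheory Set Literature.Probability.LatticeModels Literature.Probability.Percolation
open scoped Classical

namespace Consts

/-! ### Weighted double counting on a finite probability space -/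

/-- **Weighted double counting.** If every point of `S` is covered by the sets `T i` (`i ∈ I`) with total weight at least `1`
(weights `c i ≥ 0`), then `μ(S) ≤ Σ_{i∈I} c_i · μ(S ∩ T i)`. [folklore] -/
theorem measureReal_le_sum_mul_inter {α ι : Type*} [Fintype α] [MeasurableSpace α] [MeasurableSingletonClass α]
    (μ : Measure α) [IsFiniteMeasure μ] (S : Set α) (I : Finset ι) (T : ι → Set α) (c : ι → ℝ) (hc0 : ∀ i ∈ I, 0 ≤ c i)
    (hc : ∀ x ∈ S, 1 ≤ ∑ i ∈ I, c i * (T i).indicator (fun _ => (1 : ℝ)) x) :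
    μ.real S ≤ ∑ i ∈ I, c i * μ.real (S ∩ T i) := by
  have key : ∀ V : Set α, μ.real V = ∑ x, V.indicator (fun x => μ.real {x}) x := fun V => by
    rw [measureReal_eq_sum_ite_mem μ V]
    exact Finset.sum_congr rfl fun x _ => (Set.indicator_apply V (fun y => μ.real {y}) x).symm
  have hrhs : ∑ i ∈ I, c i * μ.real (S ∩ T i) = ∑ x, ∑ i ∈ I, c i * (S ∩ T i).indicator (fun x => μ.real {x}) x := by
    rw [Finset.sum_comm]
    exact Finset.sum_congr rfl fun i _ => by rw [key (S ∩ T i), Finset.mul_sum]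
  rw [key S, hrhs]
  refine Finset.sum_le_sum fun x _ => ?_
  by_cases hx : x ∈ S
  · rw [Set.indicator_of_mem hx]
    have h1 : ∀ i ∈ I, c i * (S ∩ T i).indicator (fun x => μ.real {x}) x =
        (c i * (T i).indicator (fun _ => (1 : ℝ)) x) * μ.real {x} := by
      intro i _
      by_cases hi : x ∈ T i
      · rw [Set.indicator_of_mem (Set.mem_inter hx hi), Set.indicator_of_mem hi, mul_one]
      · rw [Set.indicator_of_notMem (fun h => hi h.2), Set.indicator_of_notMem hi, mul_zero, zero_mul]
    rw [Finset.sum_congr rfl h1, ← Finset.sum_mul]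
    have := hc x hx
    nlinarith [measureReal_nonneg (μ := μ) (s := {x})]
  · rw [Set.indicator_of_notMem hx]
    refine Finset.sum_nonneg fun i hi => mul_nonneg (hc0 i hi) (Set.indicator_nonneg (fun _ _ => measureReal_nonneg) _)

/-! ### The pair-LP bound -/

/-- The key polynomial identity behind the charging weights: `(M − N)(M − θ − 1 + N) = (M − 1)(M − θ) + (N − 1)(θ − N)`. -/
theorem pairLP_identity (M N θ : ℝ) : (M - N) * (M - θ - 1 + N) = (M - 1) * (M - θ) + (N - 1) * (θ - N) := by ring

set_option maxHeartbeats 400000 in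
/-- **The pair-LP bound: `P(1 ≤ N < κ·EN) ≤ (1 + 1/(2(1−κ)))·s`** for `0 < κ < 1`, pairwise unreliability `≤ s` (`s ≥ 0`), and
every observer `o` (see the module docstring for the charging scheme). [cite: KozmaNitzan2024, Conj. 1 (p. 3)] -/
theorem real_lowerTail_le_pairLP (n : ℕ) (w : Sym2 (Fin n) → unitInterval) (A : Finset (Fin n)) (o : Fin n)
    {κ s : ℝ} (hκ0 : 0 < κ) (hκ1 : κ < 1) (hs : 0 ≤ s)
    (hrel : ∀ a ∈ A, ∀ a' ∈ A, (prodBernoulli w).real (openConn a a')ᶜ ≤ s) :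
    (prodBernoulli w).real {ω : BondConfig (Fin n) | 1 ≤ (A.filter fun a => ω ∈ openConn o a).card ∧
        ((A.filter fun a => ω ∈ openConn o a).card : ℝ) < κ * (∑ a ∈ A, (prodBernoulli w).real (openConn o a))} ≤
      (1 + 1 / (2 * (1 - κ))) * s := by
  set μ := prodBernoulli w with hμ
  set M : ℕ := A.card with hMdef
  set EN : ℝ := ∑ a ∈ A, μ.real (openConn o a) with hEN
  set bad := {ω : BondConfig (Fin n) | 1 ≤ (A.filter fun a => ω ∈ openConn o a).card ∧
        ((A.filter fun a => ω ∈ openConn o a).card : ℝ) < κ * EN} with hbad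
  have h1κ : 0 < 1 - κ := by linarith
  have hT0 : 0 ≤ (1 + 1 / (2 * (1 - κ))) * s := mul_nonneg (by positivity) hs
  have hENle : EN ≤ M := by
    calc EN = ∑ a ∈ A, μ.real (openConn o a) := rfl
      _ ≤ ∑ _a ∈ A, (1 : ℝ) := Finset.sum_le_sum fun a _ => measureReal_le_one
      _ = M := by rw [Finset.sum_const, nsmul_eq_mul, mul_one]
  have hNle : ∀ ω : BondConfig (Fin n), (A.filter fun a => ω ∈ openConn o a).card ≤ M := fun ω =>
    Finset.card_filter_le _ _
  -- small relay sets: the bad event is empty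
  by_cases hM : M ≤ 1
  · have hempty : bad = ∅ := by
      ext ω
      simp only [hbad, mem_setOf_eq, mem_empty_iff_false, iff_false, not_and, not_lt]
      intro h1
      have hM1 : (M : ℝ) ≤ 1 := by exact_mod_cast hM
      have : (1 : ℝ) ≤ (A.filter fun a => ω ∈ openConn o a).card := by exact_mod_cast h1
      nlinarith
    rw [hempty, measureReal_empty]
    exact hT0
  push Not at hM
  have hM2 : (2 : ℝ) ≤ M := by exact_mod_cast hM
  have hM0 : (0 : ℝ) < M := by linarith
  -- tiny `κ`: the bad event is empty as well (`N < κ EN ≤ κ M < 1`)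
  by_cases hκM : κ * M < 1
  · have hempty : bad = ∅ := by
      ext ω
      simp only [hbad, mem_setOf_eq, mem_empty_iff_false, iff_false, not_and, not_lt]
      intro h1
      have : (1 : ℝ) ≤ (A.filter fun a => ω ∈ openConn o a).card := by exact_mod_cast h1
      have : κ * EN ≤ κ * M := mul_le_mul_of_nonneg_left hENle hκ0.le
      linarith
    rw [hempty, measureReal_empty]
    exact hT0
  push Not at hκM
  -- the threshold `θ = min (κ M) (M − 1)` and the weights
  set θ : ℝ := min (κ * M) (M - 1) with hθ
  have hθM1 : θ ≤ M - 1 := min_le_right _ _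
  have hθκ : θ ≤ κ * M := min_le_left _ _
  have hθ1 : 1 ≤ θ := le_min hκM (by linarith)
  have hMθ : 0 < (M : ℝ) - θ := by linarith
  have hM1 : 0 < (M : ℝ) - 1 := by linarith
  set α : ℝ := (M - θ - 1) / ((M - 1) * (M - θ)) with hα
  set β : ℝ := 1 / ((M - 1) * (M - θ)) with hβ
  have hα0 : 0 ≤ α := div_nonneg (by linarith) (by positivity)
  have hβ0 : 0 ≤ β := by positivity
  -- pointwise covering: `(M − N)(α + β N) ≥ 1` for `1 ≤ N ≤ θ`
  have hcover : ∀ N : ℝ, 1 ≤ N → N ≤ θ → 1 ≤ (M - N) * (α + β * N) := by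
    intro N hN1 hNθ
    have hprod : 0 < ((M : ℝ) - 1) * (M - θ) := by positivity
    have : (M - N) * (α + β * N) = (M - N) * (M - θ - 1 + N) / ((M - 1) * (M - θ)) := by
      rw [hα, hβ]; field_simp
    rw [this, le_div_iff₀ hprod, pairLP_identity]
    nlinarith
  -- the two families of events
  set E : Fin n → Set (BondConfig (Fin n)) := fun y => (⋃ a ∈ A, openConn o a) \ openConn o y with hE
  set T : Fin n → Fin n → Set (BondConfig (Fin n)) := fun x y => openConn o x ∩ (openConn o y)ᶜ with hTdef
  set F : Option (Fin n) × Fin n → Set (BondConfig (Fin n)) := fun p => Option.elim p.1 (E p.2) (fun x => T x p.2) with hF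
  set c : Option (Fin n) × Fin n → ℝ := fun p => Option.elim p.1 α (fun x => if x ∈ A then β else 0) with hc
  set I : Finset (Option (Fin n) × Fin n) := Finset.univ ×ˢ A with hI
  have hc0 : ∀ p ∈ I, 0 ≤ c p := by
    rintro ⟨k, y⟩ -
    rcases k with _ | x
    · exact hα0
    · change 0 ≤ (if x ∈ A then β else 0)
      split_ifs
      · exact hβ0
      · exact le_rfl
  -- evaluating the weighted count on a configuration
  have hsumI : ∀ (f : Option (Fin n) × Fin n → ℝ),
      ∑ p ∈ I, f p = ∑ y ∈ A, (f (none, y) + ∑ x, f (some x, y)) := by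
    intro f
    rw [hI, Finset.sum_product_right]
    refine Finset.sum_congr rfl fun y _ => ?_
    rw [Fintype.sum_option]
  have hcount : ∀ ω ∈ bad, 1 ≤ ∑ p ∈ I, c p * (F p).indicator (fun _ => (1 : ℝ)) ω := by
    intro ω hω
    obtain ⟨hN1, hNlt⟩ := hω
    set Nω : ℕ := (A.filter fun a => ω ∈ openConn o a).card with hNω
    have hU : ω ∈ ⋃ a ∈ A, openConn o a := by
      obtain ⟨a₁, ha₁⟩ := Finset.card_pos.1 hN1
      rw [Finset.mem_filter] at ha₁
      exact Set.mem_iUnion₂.2 ⟨a₁, ha₁.1, ha₁.2⟩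
    -- indicators
    have hindE : ∀ y, (E y).indicator (fun _ => (1 : ℝ)) ω = 1 - (if ω ∈ openConn o y then (1 : ℝ) else 0) := by
      intro y
      by_cases h : ω ∈ openConn o y
      · rw [Set.indicator_of_notMem (fun hh : ω ∈ E y => hh.2 h), if_pos h, sub_self]
      · rw [Set.indicator_of_mem (show ω ∈ E y from ⟨hU, h⟩), if_neg h, sub_zero]
    have hindT : ∀ x y, (T x y).indicator (fun _ => (1 : ℝ)) ω =
        (if ω ∈ openConn o x then (1 : ℝ) else 0) * (1 - (if ω ∈ openConn o y then (1 : ℝ) else 0)) := by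
      intro x y
      by_cases hx : ω ∈ openConn o x <;> by_cases hy : ω ∈ openConn o y
      · rw [Set.indicator_of_notMem (fun hh : ω ∈ T x y => hh.2 hy), if_pos hx, if_pos hy]; ring
      · rw [Set.indicator_of_mem (show ω ∈ T x y from ⟨hx, hy⟩), if_pos hx, if_neg hy]; ring
      · rw [Set.indicator_of_notMem (fun hh : ω ∈ T x y => hx hh.1), if_neg hx, if_pos hy]; ring
      · rw [Set.indicator_of_notMem (fun hh : ω ∈ T x y => hx hh.1), if_neg hx, if_neg hy]; ring
    have hNsum : (∑ y ∈ A, if ω ∈ openConn o y then (1 : ℝ) else 0) = Nω := by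
      rw [Finset.sum_boole, hNω]
    have hval : ∑ p ∈ I, c p * (F p).indicator (fun _ => (1 : ℝ)) ω = ((M : ℝ) - Nω) * (α + β * Nω) := by
      rw [hsumI]
      have hinner : ∀ y ∈ A, (c (none, y) * (F (none, y)).indicator (fun _ => (1 : ℝ)) ω +
          ∑ x, c (some x, y) * (F (some x, y)).indicator (fun _ => (1 : ℝ)) ω) =
          (1 - (if ω ∈ openConn o y then (1 : ℝ) else 0)) * (α + β * Nω) := by
        intro y _
        have h1 : c (none, y) * (F (none, y)).indicator (fun _ => (1 : ℝ)) ω =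
            α * (1 - (if ω ∈ openConn o y then (1 : ℝ) else 0)) := by
          change α * (E y).indicator (fun _ => (1 : ℝ)) ω = _
          rw [hindE]
        have h2 : ∑ x, c (some x, y) * (F (some x, y)).indicator (fun _ => (1 : ℝ)) ω =
            β * Nω * (1 - (if ω ∈ openConn o y then (1 : ℝ) else 0)) := by
          have h3 : ∀ x, c (some x, y) * (F (some x, y)).indicator (fun _ => (1 : ℝ)) ω =
              (if x ∈ A then β else 0) * ((if ω ∈ openConn o x then (1 : ℝ) else 0) *
                (1 - (if ω ∈ openConn o y then (1 : ℝ) else 0))) := by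
            intro x
            change (if x ∈ A then β else 0) * (T x y).indicator (fun _ => (1 : ℝ)) ω = _
            rw [hindT]
          rw [Finset.sum_congr rfl fun x _ => h3 x, ← Finset.sum_filter_add_sum_filter_not Finset.univ (· ∈ A)]
          have hfA : Finset.univ.filter (· ∈ A) = A := by ext x; simp
          have hzero : ∑ x ∈ Finset.univ.filter (fun x => ¬ x ∈ A), (if x ∈ A then β else 0) *
              ((if ω ∈ openConn o x then (1 : ℝ) else 0) * (1 - (if ω ∈ openConn o y then (1 : ℝ) else 0))) = 0 :=
            Finset.sum_eq_zero fun x hx => by rw [if_neg (Finset.mem_filter.1 hx).2, zero_mul]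
          rw [hzero, add_zero, hfA]
          have h4 : ∀ x ∈ A, (if x ∈ A then β else 0) * ((if ω ∈ openConn o x then (1 : ℝ) else 0) *
              (1 - (if ω ∈ openConn o y then (1 : ℝ) else 0))) =
              (β * (1 - (if ω ∈ openConn o y then (1 : ℝ) else 0))) * (if ω ∈ openConn o x then (1 : ℝ) else 0) := by
            intro x hx; rw [if_pos hx]; ring
          rw [Finset.sum_congr rfl h4, ← Finset.mul_sum, hNsum]; ring
        rw [h1, h2]; ring
      rw [Finset.sum_congr rfl hinner, ← Finset.sum_mul, Finset.sum_sub_distrib, Finset.sum_const, nsmul_eq_mul, mul_one,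
        hNsum]
    rw [hval]
    refine hcover Nω (by exact_mod_cast hN1) ?_
    -- `N ≤ θ`: `N < κ EN ≤ κ M` and `N ≤ M − 1` (an integer below `κ M < M`)
    have hNκ : (Nω : ℝ) < κ * M := hNlt.trans_le (mul_le_mul_of_nonneg_left hENle hκ0.le)
    have hNM1 : (Nω : ℝ) ≤ M - 1 := by
      have hlt : (Nω : ℝ) < M := hNκ.trans_le (by nlinarith)
      have : Nω < M := by exact_mod_cast hlt
      have : Nω ≤ M - 1 := by omega
      have hc : ((M - 1 : ℕ) : ℝ) = (M : ℝ) - 1 := by rw [Nat.cast_sub (by omega)]; simp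
      rw [← hc]; exact_mod_cast this
    exact le_min hNκ.le hNM1
  -- apply the weighted double counting
  have hmain := measureReal_le_sum_mul_inter μ bad I F c hc0 hcount
  -- masses of the events: one-cut gluing for `E y`, pairwise unreliability for `T x y ∪ T y x`
  have hEle : ∀ y ∈ A, μ.real (E y) ≤ s := by
    intro y hy
    have hrel' : ∀ a ∈ A, 1 - s ≤ μ.real (openConn a y) := by
      intro a ha
      have hcpl : μ.real (openConn a y)ᶜ = 1 - μ.real (openConn a y) := by
        rw [measureReal_compl MeasurableSet.of_discrete, probReal_univ]
      have := hrel a ha y hy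
      linarith
    have hAG := CSH.additiveGluing_holds n w A o y s hs hrel'
    have hsub : (openConn o y : Set (BondConfig (Fin n))) ⊆ ⋃ a ∈ A, openConn o a := fun ω hω =>
      Set.mem_iUnion₂.2 ⟨y, hy, hω⟩
    change μ.real ((⋃ a ∈ A, openConn o a) \ openConn o y) ≤ s
    rw [measureReal_sdiff hsub MeasurableSet.of_discrete (measure_ne_top _ _)]
    linarith
  have hTT : ∀ x ∈ A, ∀ y ∈ A, μ.real (T x y) + μ.real (T y x) ≤ s := by
    intro x hx y hy
    have hdisj : Disjoint (T x y) (T y x) := by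
      rw [Set.disjoint_left]
      rintro ω ⟨hx', -⟩ ⟨-, hx''⟩
      exact hx'' hx'
    have hsub : T x y ∪ T y x ⊆ (openConn x y)ᶜ := by
      rintro ω (⟨h1, h2⟩ | ⟨h1, h2⟩) hxy
      · exact h2 (h1.trans hxy)
      · exact h2 (h1.trans (SimpleGraph.Reachable.symm hxy))
    rw [← measureReal_union hdisj MeasurableSet.of_discrete]
    exact (measureReal_mono hsub (measure_ne_top _ _)).trans (hrel x hx y hy)
  -- total weighted mass `≤ α M s + β s M(M−1)/2`
  have hsumE : ∑ y ∈ A, c (none, y) * μ.real (bad ∩ F (none, y)) ≤ α * (M * s) := by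
    calc ∑ y ∈ A, c (none, y) * μ.real (bad ∩ F (none, y)) ≤ ∑ y ∈ A, α * s :=
          Finset.sum_le_sum fun y hy => by
            change α * μ.real (bad ∩ E y) ≤ α * s
            exact mul_le_mul_of_nonneg_left
              ((measureReal_mono inter_subset_right (measure_ne_top _ _)).trans (hEle y hy)) hα0
      _ = α * (M * s) := by rw [Finset.sum_const, nsmul_eq_mul, hMdef]; ring
  have hsumT : ∑ y ∈ A, ∑ x, c (some x, y) * μ.real (bad ∩ F (some x, y)) ≤ β * (s * (M * M - M) / 2) := by
    -- reduce to the sum over `x ∈ A` of `μ (T x y)`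
    have hred : ∀ y ∈ A, ∑ x, c (some x, y) * μ.real (bad ∩ F (some x, y)) ≤ β * ∑ x ∈ A, μ.real (T x y) := by
      intro y _
      have h3 : ∀ x, c (some x, y) * μ.real (bad ∩ F (some x, y)) = (if x ∈ A then β else 0) * μ.real (bad ∩ T x y) :=
        fun x => rfl
      rw [Finset.sum_congr rfl fun x _ => h3 x, ← Finset.sum_filter_add_sum_filter_not Finset.univ (· ∈ A)]
      have hfA : Finset.univ.filter (· ∈ A) = A := by ext x; simp
      have hzero : ∑ x ∈ Finset.univ.filter (fun x => ¬ x ∈ A), (if x ∈ A then β else 0) * μ.real (bad ∩ T x y) = 0 :=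
        Finset.sum_eq_zero fun x hx => by rw [if_neg (Finset.mem_filter.1 hx).2, zero_mul]
      rw [hzero, add_zero, hfA, Finset.mul_sum]
      refine Finset.sum_le_sum fun x hx => ?_
      rw [if_pos hx]
      exact mul_le_mul_of_nonneg_left (measureReal_mono inter_subset_right (measure_ne_top _ _)) hβ0
    refine (Finset.sum_le_sum hred).trans ?_
    rw [← Finset.mul_sum]
    refine mul_le_mul_of_nonneg_left ?_ hβ0
    -- symmetrise: `2 Σ_{x,y} μ(T x y) = Σ_{x,y} (μ(T x y) + μ(T y x)) ≤ s (M² − M)`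
    have hsym : ∑ y ∈ A, ∑ x ∈ A, μ.real (T x y) = ∑ y ∈ A, ∑ x ∈ A, μ.real (T y x) := Finset.sum_comm
    have hdiag : ∀ x, μ.real (T x x) = 0 := fun x => by
      have : T x x = ∅ := by ext ω; simp [hTdef]
      rw [this, measureReal_empty]
    have h2 : 2 * ∑ y ∈ A, ∑ x ∈ A, μ.real (T x y) ≤ ∑ y ∈ A, ∑ x ∈ A, (if x = y then (0 : ℝ) else s) := by
      rw [two_mul]
      nth_rewrite 2 [hsym]
      rw [← Finset.sum_add_distrib]
      refine Finset.sum_le_sum fun y hy => ?_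
      rw [← Finset.sum_add_distrib]
      refine Finset.sum_le_sum fun x hx => ?_
      split_ifs with hxy
      · subst hxy; simp [hdiag]
      · exact hTT x hx y hy
    have h3 : ∑ y ∈ A, ∑ x ∈ A, (if x = y then (0 : ℝ) else s) = s * (M * M - M) := by
      have h4 : ∀ y ∈ A, ∑ x ∈ A, (if x = y then (0 : ℝ) else s) = s * (M - 1) := by
        intro y hy
        rw [Finset.sum_ite, Finset.sum_const_zero, zero_add, Finset.sum_const, nsmul_eq_mul]
        have : (A.filter fun x => ¬ x = y).card = M - 1 := by
          rw [Finset.filter_ne', Finset.card_erase_of_mem hy]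
        rw [this, Nat.cast_sub (by omega), Nat.cast_one]; ring
      rw [Finset.sum_congr rfl h4, Finset.sum_const, nsmul_eq_mul, ← hMdef]; ring
    linarith
  have htotal : μ.real bad ≤ α * (M * s) + β * (s * (M * M - M) / 2) := by
    refine hmain.trans ?_
    rw [hsumI]
    rw [Finset.sum_add_distrib]
    linarith [hsumE, hsumT]
  -- the final estimate `α M + β M(M−1)/2 ≤ 1 + 1/(2(1−κ))`, cleared of the common denominator `(M−1)(M−θ)`
  refine htotal.trans ?_
  have hD : 0 < ((M : ℝ) - 1) * (M - θ) := mul_pos hM1 hMθ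
  have hαD : α * (((M : ℝ) - 1) * (M - θ)) = M - θ - 1 := by rw [hα]; exact div_mul_cancel₀ _ hD.ne'
  have hβD : β * (((M : ℝ) - 1) * (M - θ)) = 1 := by rw [hβ]; exact div_mul_cancel₀ _ hD.ne'
  rw [← sub_nonneg]
  have hexp : ((1 + 1 / (2 * (1 - κ))) * s - (α * (M * s) + β * (s * (M * M - M) / 2))) * (((M : ℝ) - 1) * (M - θ)) =
      s * ((1 + 1 / (2 * (1 - κ))) * ((M - 1) * (M - θ)) - ((M - θ - 1) * M + (M * M - M) / 2)) := by
    have e : ((1 + 1 / (2 * (1 - κ))) * s - (α * (M * s) + β * (s * (M * M - M) / 2))) * (((M : ℝ) - 1) * (M - θ)) =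
        s * ((1 + 1 / (2 * (1 - κ))) * ((M - 1) * (M - θ)) -
          ((α * (((M : ℝ) - 1) * (M - θ))) * M + (β * (((M : ℝ) - 1) * (M - θ))) * ((M * M - M) / 2))) := by ring
    rw [e, hαD, hβD, one_mul]
  -- it suffices that the bracket is nonnegative
  suffices hbr : 0 ≤ (1 + 1 / (2 * (1 - κ))) * (((M : ℝ) - 1) * (M - θ)) - ((M - θ - 1) * M + (M * M - M) / 2) by
    have h1 : 0 ≤ ((1 + 1 / (2 * (1 - κ))) * s - (α * (M * s) + β * (s * (M * M - M) / 2))) *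
        (((M : ℝ) - 1) * (M - θ)) := by rw [hexp]; exact mul_nonneg hs hbr
    exact nonneg_of_mul_nonneg_left h1 hD
  have hhalf : 1 / 2 * (1 / (1 - κ)) = 1 / (2 * (1 - κ)) := one_div_mul_one_div 2 (1 - κ)
  have hinv : 1 / (1 - κ) * (1 - κ) = 1 := one_div_mul_cancel h1κ.ne'
  rcases le_total (κ * M) (M - 1) with hcase | hcase
  · -- `θ = κ M`: the bracket equals `κ M (… ) ≥ 0`
    have hθeq : θ = κ * M := min_eq_left hcase
    rw [hθeq, ← hhalf]
    have e : (1 + 1 / 2 * (1 / (1 - κ))) * (((M : ℝ) - 1) * (M - κ * M)) - ((M - κ * M - 1) * M + (M * M - M) / 2) =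
        (M - 1) * (M - κ * M) + 1 / 2 * ((M - 1) * M) * (1 / (1 - κ) * (1 - κ)) -
          ((M - κ * M - 1) * M + (M * M - M) / 2) := by ring
    rw [e, hinv]
    nlinarith [mul_pos hκ0 hM0]
  · -- `θ = M − 1 ≤ κ M`: the bracket is `(M−1)(1 + 1/(2(1−κ)) − M/2) ≥ 0` since `M ≤ 1/(1−κ)`
    have hθeq : θ = M - 1 := min_eq_right hcase
    have hMκ : (M : ℝ) * (1 - κ) ≤ 1 := by nlinarith
    have hMle : (M : ℝ) ≤ 1 / (1 - κ) := by rw [le_div_iff₀ h1κ]; exact hMκ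
    rw [hθeq, ← hhalf]
    have e : (1 + 1 / 2 * (1 / (1 - κ))) * (((M : ℝ) - 1) * (M - (M - 1))) - ((M - (M - 1) - 1) * M + (M * M - M) / 2) =
        (M - 1) * (2 + 1 / (1 - κ) - M) / 2 := by ring
    rw [e]
    exact div_nonneg (mul_nonneg hM1.le (by linarith)) (by norm_num)

/-- **`(κ, 1 + 1/(2(1−κ)))` is a linear lower-tail pair for every `0 < κ < 1`** (the hypothesis shape `hLT` of
`Consts.noHeavyLowerTail_rate_of_linearLowerTail`, `…_le_const_…`). [cite: KozmaNitzan2024, Conj. 1 (p. 3)] -/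
theorem linearLowerTailPair_pairLP {κ : ℝ} (hκ0 : 0 < κ) (hκ1 : κ < 1) :
    ∀ (n : ℕ) (w : Sym2 (Fin n) → unitInterval) (A : Finset (Fin n)) (o : Fin n) (s : ℝ), 0 ≤ s →
      (∀ a ∈ A, ∀ a' ∈ A, (prodBernoulli w).real (openConn a a')ᶜ ≤ s) →
      (prodBernoulli w).real {ω : BondConfig (Fin n) | 1 ≤ (A.filter fun a => ω ∈ openConn o a).card ∧
          ((A.filter fun a => ω ∈ openConn o a).card : ℝ) < κ * (∑ a ∈ A, (prodBernoulli w).real (openConn o a))} ≤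
        (1 + 1 / (2 * (1 - κ))) * s :=
  fun n w A o _ hs hrel => real_lowerTail_le_pairLP n w A o hκ0 hκ1 hs hrel

/-- At `κ = 2/3` the kernel upper bound improves from `3` (`1/(1−κ)`) to `5/2`. [cite: KozmaNitzan2024, Conj. 1 (p. 3)] -/
theorem real_lowerTail_le_five_halves_two_thirds (n : ℕ) (w : Sym2 (Fin n) → unitInterval) (A : Finset (Fin n)) (o : Fin n)
    {s : ℝ} (hs : 0 ≤ s) (hrel : ∀ a ∈ A, ∀ a' ∈ A, (prodBernoulli w).real (openConn a a')ᶜ ≤ s) :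
    (prodBernoulli w).real {ω : BondConfig (Fin n) | 1 ≤ (A.filter fun a => ω ∈ openConn o a).card ∧
        ((A.filter fun a => ω ∈ openConn o a).card : ℝ) < 2 / 3 * (∑ a ∈ A, (prodBernoulli w).real (openConn o a))} ≤
      5 / 2 * s := by
  have h := real_lowerTail_le_pairLP n w A o (κ := 2 / 3) (by norm_num) (by norm_num) hs hrel
  have e : (1 + 1 / (2 * (1 - 2 / 3)) : ℝ) = 5 / 2 := by norm_num
  rw [e] at h
  exact h

end Consts

end Summit.CriticalPhenomena.PercolationContinuityZ3.Theorems
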